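import Summits.QuantumFields.YangMills.Theorems.ColdStartUniversalityLatticeLangevinCorrectorIncrements
import Summits.QuantumFields.YangMills.Theorems.ColdStartUniversalityLatticeLangevinMartingaleMaximal
import HarnessLib

/-!
# Route `ColdStartUniversality` (fixed-cut-off SZZ dynamics): EXPONENTIAL AND FOURTH MOMENTS OF BLOCK INTEGRALS `∫_(jb,(j+1)b] Ĝ(U_r) dr`,
# uniformly in the block position — `E(∫_(jb,(j+1)b] Ĝ)⁴ ≤ 48 e^(3/2) · b₀² (9b + 10b₀)²`, `b₀ = 2β_u`

Helper file (seat `ym-line-csu-p1`, g34; `--supports stmt-QuantumFields-24809`).  The diagonal terms of the batch-means analysis (files 86–88)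
were bounded crudely by `I_j² ≤ 4b²`, which costs a factor `b` in the rate.  The corrector increments of file 81 give the right order: on a grid
of step `h = b/n₀ ≤ b₀` (`n₀ = ⌈b/b₀⌉`) the block integral is `I_j = Σ_(k ∈ [jn₀,(j+1)n₀)) D_k − (u(U_((j+1)b)) − u(U_(jb)))`, a sum of `n₀`
increments bounded by `B ≤ 3b₀` and orthogonal to their past; hence
* ★ `integral_mul_exp_mul_sum_Ico_le` — generic UPPER companion of file 78's iterated step: `∫ Z e^(λΣ_[j,n) D) ≤ e^((n−j)λ²B²/2) ∫ Z` for
  bounded `Z ≥ 0` measurable for the past `ℱ_j`;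
* `pow_four_le_exp_add_exp` — `x⁴ ≤ 24 λ⁻⁴ (e^(λx) + e^(−λx))` (`λ > 0`);
* ★★ `integral_exp_mul_blockIntegral_le` — `E exp(λ I_j) ≤ exp(b₀|λ| + n₀λ²B²/2)`, every `j`, every real `λ` (generic corrector form);
* ★★★ `integral_blockIntegral_pow_four_le` — **`E (∫_(jb,(j+1)b] Ĝ(U_r) dr)⁴ ≤ 48·e^(3/2)·(9b₀(b + b₀) + b₀²)²`, every block `j`, every
  progressively measurable strong solution from a deterministic start, every continuous `|G| ≤ 1`, every bounded corrector `|u| ≤ β_u`** — the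
  `O(b²)` fourth moment of a `√b`-sized Gaussian-like fluctuation, uniformly in the position of the block.
THEOREMS ONLY, no definition, no sorry; [folklore].  HONEST FRAMING: fixed cut-off; `UniformColdStartMixing` (24809) is NOT restated; no crux, rung or
summit statement is proved; the Yang–Mills mass gap is NOT proved.
-/

set_option autoImplicit false

noncomputable section

namespace Summit.QuantumFields.YangMills.Theorems.ColdStartUniversality

open MeasureTheory ProbabilityTheory Filter Topology Set
open scoped NNReal ENNReal BigOperators
open Literature Literature.Probability.Process Literature.MathematicalPhysics.QuantumFieldTheory
open Literature.MathematicalPhysics.QuantumLattice (fundamentalRep fundamentalLatticeRep continuous_fundamentalRep)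

/-! ## §1. Generic pieces -/

/-- ★ **Iterated upper Hoeffding step with a weight from the past**: with increments `D_i` (`|D_i| ≤ B`, `D_i` `ℱ_(i+1)`-measurable, `ℱ`
increasing, `ℱ_k ≤ mΩ`) orthogonal to every bounded non-negative `ℱ_k`-measurable weight for `k < N`, every bounded `Z ≥ 0` that is
`ℱ_j`-measurable satisfies `∫ Z·e^(λ Σ_(i∈[j,n)) D_i) ≤ e^((n−j)λ²B²/2) ∫ Z` for `j ≤ n ≤ N`. [folklore] -/
theorem integral_mul_exp_mul_sum_Ico_le {Ω : Type*} {mΩ : MeasurableSpace Ω} {P : Measure Ω} [IsProbabilityMeasure P]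
    (ℱ : ℕ → MeasurableSpace Ω) (hℱle : ∀ k, ℱ k ≤ mΩ) (hℱmono : Monotone ℱ)
    (D : ℕ → Ω → ℝ) (hDF : ∀ k, Measurable[ℱ (k + 1)] (D k)) {B : ℝ} (hB : 0 < B) (hDb : ∀ k ω, |D k ω| ≤ B) (N : ℕ)
    (horth : ∀ k < N, ∀ (Z : Ω → ℝ), Measurable[ℱ k] Z → (∀ ω, 0 ≤ Z ω) → (∃ CZ : ℝ, ∀ ω, Z ω ≤ CZ) →
      ∫ ω, Z ω * D k ω ∂P = 0)
    {j : ℕ} {Z : Ω → ℝ} (hZF : Measurable[ℱ j] Z) (hZ0 : ∀ ω, 0 ≤ Z ω) {CZ : ℝ} (hZb : ∀ ω, Z ω ≤ CZ) (l : ℝ)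
    {n : ℕ} (hjn : j ≤ n) (hnN : n ≤ N) :
    ∫ ω, Z ω * Real.exp (l * ∑ i ∈ Finset.Ico j n, D i ω) ∂P ≤ Real.exp ((n - j : ℕ) * (l ^ 2 * B ^ 2 / 2)) * ∫ ω, Z ω ∂P := by
  induction n, hjn using Nat.le_induction with
  | base => simp
  | succ n hjn ih =>
    have ih' := ih (Nat.le_of_succ_le hnN)
    have hDm : ∀ k, Measurable (D k) := fun k => (hDF k).mono (hℱle _) le_rfl
    have hSF : Measurable[ℱ n] fun ω => ∑ i ∈ Finset.Ico j n, D i ω := by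
      refine Finset.measurable_sum _ fun i hi => ?_
      exact (hDF i).mono (hℱmono (Nat.succ_le_of_lt (Finset.mem_Ico.1 hi).2)) le_rfl
    have hZ'F : Measurable[ℱ n] fun ω => Z ω * Real.exp (l * ∑ i ∈ Finset.Ico j n, D i ω) :=
      (hZF.mono (hℱmono hjn) le_rfl).mul (hSF.const_mul l).exp
    have hZ'm : Measurable fun ω => Z ω * Real.exp (l * ∑ i ∈ Finset.Ico j n, D i ω) := hZ'F.mono (hℱle n) le_rfl
    have hSb : ∀ ω, |∑ i ∈ Finset.Ico j n, D i ω| ≤ (n - j : ℕ) * B := fun ω =>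
      (Finset.abs_sum_le_sum_abs _ _).trans (by
        calc ∑ i ∈ Finset.Ico j n, |D i ω| ≤ ∑ _i ∈ Finset.Ico j n, B := Finset.sum_le_sum fun i _ => hDb i ω
          _ = (n - j : ℕ) * B := by rw [Finset.sum_const, Nat.card_Ico, nsmul_eq_mul])
    have hZ'0 : ∀ ω, 0 ≤ Z ω * Real.exp (l * ∑ i ∈ Finset.Ico j n, D i ω) := fun ω => mul_nonneg (hZ0 ω) (Real.exp_pos _).le
    have hZ'b : ∀ ω, Z ω * Real.exp (l * ∑ i ∈ Finset.Ico j n, D i ω) ≤ CZ * Real.exp (|l| * ((n - j : ℕ) * B)) := fun ω => by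
      refine mul_le_mul (hZb ω) ?_ (Real.exp_pos _).le ((hZ0 ω).trans (hZb ω))
      rw [Real.exp_le_exp]
      calc l * ∑ i ∈ Finset.Ico j n, D i ω ≤ |l * ∑ i ∈ Finset.Ico j n, D i ω| := le_abs_self _
        _ = |l| * |∑ i ∈ Finset.Ico j n, D i ω| := abs_mul _ _
        _ ≤ |l| * ((n - j : ℕ) * B) := mul_le_mul_of_nonneg_left (hSb ω) (abs_nonneg l)
    have hstep := integral_mul_exp_mul_le_of_orthogonal hZ'm (hDm n) hZ'0 hZ'b hB (hDb n)
      (horth n (Nat.lt_of_succ_le hnN) _ hZ'F hZ'0 ⟨_, hZ'b⟩) l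
    have heq : ∀ ω, Z ω * Real.exp (l * ∑ i ∈ Finset.Ico j (n + 1), D i ω) =
        Z ω * Real.exp (l * ∑ i ∈ Finset.Ico j n, D i ω) * Real.exp (l * D n ω) := fun ω => by
      rw [Finset.sum_Ico_succ_top hjn, mul_add, Real.exp_add, mul_assoc]
    rw [integral_congr_ae (ae_of_all _ heq)]
    calc ∫ ω, Z ω * Real.exp (l * ∑ i ∈ Finset.Ico j n, D i ω) * Real.exp (l * D n ω) ∂P
        ≤ Real.exp (l ^ 2 * B ^ 2 / 2) * ∫ ω, Z ω * Real.exp (l * ∑ i ∈ Finset.Ico j n, D i ω) ∂P := hstep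
      _ ≤ Real.exp (l ^ 2 * B ^ 2 / 2) * (Real.exp ((n - j : ℕ) * (l ^ 2 * B ^ 2 / 2)) * ∫ ω, Z ω ∂P) :=
          mul_le_mul_of_nonneg_left ih' (Real.exp_pos _).le
      _ = Real.exp ((n + 1 - j : ℕ) * (l ^ 2 * B ^ 2 / 2)) * ∫ ω, Z ω ∂P := by
          rw [← mul_assoc, ← Real.exp_add]
          congr 2
          have : (n + 1 - j : ℕ) = (n - j : ℕ) + 1 := by omega
          rw [this]; push_cast; ring

/-- `x⁴ ≤ 24·λ⁻⁴·(e^(λx) + e^(−λx))` for `λ > 0` (`y⁴/4! ≤ e^y` at `y = λ|x|`). [folklore] -/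
theorem pow_four_le_exp_add_exp {l : ℝ} (hl : 0 < l) (x : ℝ) :
    x ^ 4 ≤ 24 / l ^ 4 * (Real.exp (l * x) + Real.exp (-(l * x))) := by
  have h1 := Real.pow_div_factorial_le_exp (l * |x|) (by positivity) 4
  have h24 : ((Nat.factorial 4 : ℕ) : ℝ) = 24 := by norm_num [Nat.factorial]
  rw [h24] at h1
  have h2 : Real.exp (l * |x|) ≤ Real.exp (l * x) + Real.exp (-(l * x)) := by
    rcases le_total 0 x with hx | hx
    · rw [abs_of_nonneg hx]; linarith [Real.exp_pos (-(l * x))]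
    · rw [abs_of_nonpos hx, mul_neg]; linarith [Real.exp_pos (l * x)]
  have hx4 : |x| ^ 4 = x ^ 4 := by rw [show (4 : ℕ) = 2 * 2 from rfl, pow_mul, sq_abs, ← pow_mul]
  have h3 : (l * |x|) ^ 4 = l ^ 4 * x ^ 4 := by rw [mul_pow, hx4]
  rw [h3] at h1
  have hl4 : 0 < l ^ 4 := by positivity
  rw [div_mul_eq_mul_div, le_div_iff₀ hl4]
  calc x ^ 4 * l ^ 4 = (l ^ 4 * x ^ 4 / 24) * 24 := by ring
    _ ≤ Real.exp (l * |x|) * 24 := by gcongr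
    _ ≤ (Real.exp (l * x) + Real.exp (-(l * x))) * 24 := by gcongr
    _ = 24 * (Real.exp (l * x) + Real.exp (-(l * x))) := by ring

/-! ## §2. Block integrals along a strong solution -/

variable {L : ℕ} [NeZero L]

/-- ★★★ **Exponential and fourth moments of block integrals, uniformly in the block position.**  For every realising kernel family `κ`,
continuous `|G| ≤ 1`, bounded measurable corrector `u` (`|u| ≤ β_u`, mild Poisson equation for `Ĝ = G − μ_(β')G`), every progressively measurable
strong solution from a deterministic start on ANY space, every block length `b > 0` and every block index `j`, with `b₀ = 2β_u`:
`E exp(λ ∫_(jb,(j+1)b] Ĝ(U_r) dr) ≤ exp(b₀|λ| + λ²·(9b₀(b+b₀))/2)` for all real `λ`, and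
`E (∫_(jb,(j+1)b] Ĝ(U_r) dr)⁴ ≤ 48·e^(3/2)·(9b₀(b+b₀) + b₀²)²`. [folklore] -/
theorem integral_blockIntegral_exp_and_pow_four_le (β' : ℝ)
    (κ : ℝ≥0 → Kernel (GaugeConfig 3 L (Matrix.specialUnitaryGroup (Fin 2) ℂ))
      (GaugeConfig 3 L (Matrix.specialUnitaryGroup (Fin 2) ℂ))) [∀ t, IsMarkovKernel (κ t)]
    (hreal : ∀ (t : ℝ≥0) (x : GaugeConfig 3 L (Matrix.specialUnitaryGroup (Fin 2) ℂ))
        (Ω : Type) [MeasurableSpace Ω] (P : Measure Ω) [IsProbabilityMeasure P]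
        (W : ℝ≥0 → Ω → (Edge 3 L × NoiseIdx 2 → ℝ)) (hW : IsFlatBrownian W P)
        (U : ℝ≥0 → Ω → GaugeConfig 3 L (Matrix.specialUnitaryGroup (Fin 2) ℂ)),
        (∀ ω, U 0 ω = x) →
        (latticeLangevinDynamics (fundamentalLatticeRep 2) β').IsSolution (fundamentalRep (Fin 2))
          hW.natFiltration P W U →
        κ t x = P.map (U t))
    {G : GaugeConfig 3 L (Matrix.specialUnitaryGroup (Fin 2) ℂ) → ℝ} (hG : Continuous G) (hG1 : ∀ z, |G z| ≤ 1)
    {u : GaugeConfig 3 L (Matrix.specialUnitaryGroup (Fin 2) ℂ) → ℝ} (hum : Measurable u) {βu : ℝ} (hβu : 0 < βu) (hu_b : ∀ y, |u y| ≤ βu)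
    (hPois : ∀ (s : ℝ≥0) (y : GaugeConfig 3 L (Matrix.specialUnitaryGroup (Fin 2) ℂ)),
      (∫ z, u z ∂(κ s y)) - u y = -∫ t in (0 : ℝ)..(s : ℝ),
        (∫ z, (G z - ∫ z', G z' ∂(wilsonMeasure (d := 3) (L := L) (fundamentalRep (Fin 2)) β')) ∂(κ t.toNNReal y)))
    (x : GaugeConfig 3 L (Matrix.specialUnitaryGroup (Fin 2) ℂ))
    {Ω : Type} [MeasurableSpace Ω] {P : Measure Ω} [IsProbabilityMeasure P]
    {W : ℝ≥0 → Ω → (Edge 3 L × NoiseIdx 2 → ℝ)} (hW : IsFlatBrownian W P)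
    {U : ℝ≥0 → Ω → GaugeConfig 3 L (Matrix.specialUnitaryGroup (Fin 2) ℂ)} (hU0 : ∀ ω, U 0 ω = x)
    (hU : (latticeLangevinDynamics (fundamentalLatticeRep 2) β').IsSolution (fundamentalRep (Fin 2)) hW.natFiltration P W U)
    (hprog : ∀ i : ℝ≥0, Measurable[@Prod.instMeasurableSpace (Set.Iic i) Ω inferInstance (hW.natFiltration i)]
      (fun q : Set.Iic i × Ω => U q.1 q.2))
    {b : ℝ} (hb : 0 < b) (j : ℕ) :
    (∀ l : ℝ, ∫ ω, Real.exp (l * ∫ r in Ioc ((j : ℝ) * b) (((j : ℝ) + 1) * b),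
        (G (U r.toNNReal ω) - ∫ z', G z' ∂(wilsonMeasure (d := 3) (L := L) (fundamentalRep (Fin 2)) β'))) ∂P ≤
      Real.exp (2 * βu * |l| + l ^ 2 * (9 * (2 * βu) * (b + 2 * βu)) / 2)) ∧
    ∫ ω, (∫ r in Ioc ((j : ℝ) * b) (((j : ℝ) + 1) * b),
        (G (U r.toNNReal ω) - ∫ z', G z' ∂(wilsonMeasure (d := 3) (L := L) (fundamentalRep (Fin 2)) β'))) ^ 4 ∂P ≤
      48 * Real.exp (3 / 2) * (9 * (2 * βu) * (b + 2 * βu) + (2 * βu) ^ 2) ^ 2 := by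
  classical
  haveI := secondCountableTopology_su2
  haveI := borelSpace_config L
  set m : ℝ := ∫ z', G z' ∂(wilsonMeasure (d := 3) (L := L) (fundamentalRep (Fin 2)) β') with hm
  set b₀ : ℝ := 2 * βu with hb₀
  have hb₀0 : 0 < b₀ := by positivity
  -- the grid `h = b/n₀`, `n₀ = ⌈b/b₀⌉`
  set n₀ : ℕ := ⌈b / b₀⌉₊ with hn₀
  have hbb : 0 < b / b₀ := div_pos hb hb₀0
  have hn₀0 : 0 < n₀ := Nat.ceil_pos.2 hbb
  have hn₀r : (0 : ℝ) < n₀ := by exact_mod_cast hn₀0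
  have hn₀ge : b / b₀ ≤ n₀ := Nat.le_ceil _
  have hn₀lt : (n₀ : ℝ) < b / b₀ + 1 := Nat.ceil_lt_add_one hbb.le
  set h : ℝ := b / n₀ with hh
  have hh0 : 0 < h := div_pos hb hn₀r
  have hhb : h ≤ b₀ := by
    rw [hh, div_le_iff₀ hn₀r]
    calc b = b / b₀ * b₀ := by field_simp
      _ ≤ n₀ * b₀ := by gcongr
      _ = b₀ * n₀ := mul_comm _ _
  have hnh : (n₀ : ℝ) * h = b := by rw [hh]; field_simp
  obtain ⟨D, hDF, hDb, horth, hsum⟩ := exists_correctorIncrements β' κ hreal hG hG1 hum hu_b hPois x hW hU0 hU hprog hh0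
  set B : ℝ := 2 * βu + 2 * h with hB
  have hB0 : 0 < B := by positivity
  have hB3 : B ≤ 3 * b₀ := by rw [hB, hb₀]; linarith
  have hℱmono : Monotone fun k : ℕ => hW.natFiltration ((k : ℝ) * h).toNNReal := fun i k hik =>
    hW.natFiltration.mono (Real.toNNReal_le_toNNReal (mul_le_mul_of_nonneg_right (by exact_mod_cast hik) hh0.le))
  -- the block as a difference of prefix sums
  set Ij : Ω → ℝ := fun ω => ∫ r in Ioc ((j : ℝ) * b) (((j : ℝ) + 1) * b), (G (U r.toNNReal ω) - m) with hIj
  have hJm : Measurable fun q : Ω × ℝ => U q.2.toNNReal q.1 :=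
    measurable_uncurry_of_prog (Z := U) (fun n : ℕ => hW.natFiltration n) (fun n => hW.natFiltration.le n) (fun n => hprog n)
  have hGhm : Measurable fun z => G z - m := hG.measurable.sub measurable_const
  have hm1 : |m| ≤ 1 := by
    haveI : IsProbabilityMeasure (wilsonMeasure (d := 3) (L := L) (fundamentalRep (Fin 2)) β') :=
      isProbabilityMeasure_wilsonMeasure (d := 3) (L := L) (fundamentalRep (Fin 2)) (continuous_fundamentalRep (Fin 2)) β'
    have hh' := norm_integral_le_of_norm_le_const (μ := wilsonMeasure (d := 3) (L := L) (fundamentalRep (Fin 2)) β') (f := G) (C := 1)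
      (Eventually.of_forall fun z => by simpa [Real.norm_eq_abs] using hG1 z)
    simpa [Real.norm_eq_abs] using hh'
  have hGhb : ∀ z, |G z - m| ≤ 2 := fun z => (abs_sub _ _).trans (by linarith [hG1 z, hm1])
  have hsec : ∀ ω, Measurable fun r : ℝ => G (U r.toNNReal ω) - m := fun ω => hGhm.comp (hJm.comp (measurable_const.prodMk measurable_id))
  have hii : ∀ ω (a a' : ℝ), IntervalIntegrable (fun r => G (U r.toNNReal ω) - m) volume a a' := fun ω a a' =>
    (intervalIntegrable_const (c := (2 : ℝ))).mono_fun' ((hsec ω).aestronglyMeasurable)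
      (ae_of_all _ fun r => by simp only [Real.norm_eq_abs]; exact hGhb _)
  have ht1 : ((j * n₀ : ℕ) : ℝ) * h = (j : ℝ) * b := by push_cast; rw [mul_assoc, hnh]
  have ht2 : (((j + 1) * n₀ : ℕ) : ℝ) * h = ((j : ℝ) + 1) * b := by push_cast; rw [mul_assoc, hnh]
  have hIeq : ∀ ω, Ij ω = (∑ k ∈ Finset.Ico (j * n₀) ((j + 1) * n₀), D k ω) -
      (u (U ((((j : ℝ) + 1) * b).toNNReal) ω) - u (U (((j : ℝ) * b).toNNReal) ω)) := by
    intro ω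
    have hle : j * n₀ ≤ (j + 1) * n₀ := Nat.mul_le_mul_right _ (Nat.le_succ j)
    have h1 := hsum ((j + 1) * n₀) ω
    have h2 := hsum (j * n₀) ω
    rw [ht2] at h1
    rw [ht1] at h2
    have hIco : ∑ k ∈ Finset.Ico (j * n₀) ((j + 1) * n₀), D k ω =
        (∑ k ∈ Finset.range ((j + 1) * n₀), D k ω) - ∑ k ∈ Finset.range (j * n₀), D k ω := by
      rw [← Finset.sum_range_add_sum_Ico _ hle]; ring
    have hsplit : (∫ r in Ioc (0 : ℝ) (((j : ℝ) + 1) * b), (G (U r.toNNReal ω) - m)) =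
        (∫ r in Ioc (0 : ℝ) ((j : ℝ) * b), (G (U r.toNNReal ω) - m)) + Ij ω := by
      have hj0 : (0 : ℝ) ≤ (j : ℝ) * b := by positivity
      have hjj : (j : ℝ) * b ≤ ((j : ℝ) + 1) * b := by nlinarith
      simp only [hIj]
      rw [← intervalIntegral.integral_of_le (hj0.trans hjj), ← intervalIntegral.integral_of_le hj0, ← intervalIntegral.integral_of_le hjj,
        intervalIntegral.integral_add_adjacent_intervals (hii ω _ _) (hii ω _ _)]
    rw [hIco, h1, h2, hsplit]; ring
  -- exponential moments
  have hmgf : ∀ l : ℝ, ∫ ω, Real.exp (l * Ij ω) ∂P ≤ Real.exp (b₀ * |l| + l ^ 2 * (9 * b₀ * (b + b₀)) / 2) := by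
    intro l
    have hle : j * n₀ ≤ (j + 1) * n₀ := Nat.mul_le_mul_right _ (Nat.le_succ j)
    have hup := integral_mul_exp_mul_sum_Ico_le (fun k : ℕ => hW.natFiltration ((k : ℝ) * h).toNNReal) (fun k => hW.natFiltration.le _) hℱmono
      D hDF hB0 hDb ((j + 1) * n₀) (fun k _ => horth k) (j := j * n₀) (Z := fun _ => (1 : ℝ)) measurable_const (fun _ => zero_le_one)
      (CZ := 1) (fun _ => le_rfl) l hle le_rfl
    simp only [one_mul, integral_const, smul_eq_mul, probReal_univ, mul_one] at hup
    have hcount : (((j + 1) * n₀ - j * n₀ : ℕ) : ℝ) = n₀ := by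
      have : (j + 1) * n₀ - j * n₀ = n₀ := by rw [Nat.add_mul, one_mul, Nat.add_sub_cancel_left]
      rw [this]
    rw [hcount] at hup
    -- pointwise `exp(λ I) ≤ e^(b₀|λ|) exp(λ ΣD)`
    have hSm : Measurable fun ω => ∑ k ∈ Finset.Ico (j * n₀) ((j + 1) * n₀), D k ω :=
      Finset.measurable_sum _ fun k _ => (hDF k).mono (hW.natFiltration.le _) le_rfl
    have hSb : ∀ ω, |∑ k ∈ Finset.Ico (j * n₀) ((j + 1) * n₀), D k ω| ≤ n₀ * B := fun ω =>
      (Finset.abs_sum_le_sum_abs _ _).trans (by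
        calc ∑ k ∈ Finset.Ico (j * n₀) ((j + 1) * n₀), |D k ω| ≤ ∑ _k ∈ Finset.Ico (j * n₀) ((j + 1) * n₀), B :=
              Finset.sum_le_sum fun k _ => hDb k ω
          _ = n₀ * B := by
              rw [Finset.sum_const, Nat.card_Ico, nsmul_eq_mul]
              have : (j + 1) * n₀ - j * n₀ = n₀ := by rw [Nat.add_mul, one_mul, Nat.add_sub_cancel_left]
              rw [this])
    have hexpi : Integrable (fun ω => Real.exp (l * ∑ k ∈ Finset.Ico (j * n₀) ((j + 1) * n₀), D k ω)) P := by
      refine (integrable_const (Real.exp (|l| * (n₀ * B)))).mono' (hSm.const_mul l).exp.aestronglyMeasurable (Eventually.of_forall fun ω => ?_)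
      rw [Real.norm_eq_abs, abs_of_pos (Real.exp_pos _), Real.exp_le_exp]
      calc l * ∑ k ∈ Finset.Ico (j * n₀) ((j + 1) * n₀), D k ω ≤ |l * ∑ k ∈ Finset.Ico (j * n₀) ((j + 1) * n₀), D k ω| := le_abs_self _
        _ = |l| * |∑ k ∈ Finset.Ico (j * n₀) ((j + 1) * n₀), D k ω| := abs_mul _ _
        _ ≤ |l| * (n₀ * B) := mul_le_mul_of_nonneg_left (hSb ω) (abs_nonneg l)
    have hpt : ∀ ω, Real.exp (l * Ij ω) ≤ Real.exp (b₀ * |l|) * Real.exp (l * ∑ k ∈ Finset.Ico (j * n₀) ((j + 1) * n₀), D k ω) := by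
      intro ω
      rw [hIeq ω, ← Real.exp_add, Real.exp_le_exp, mul_sub]
      have hdu : |u (U ((((j : ℝ) + 1) * b).toNNReal) ω) - u (U (((j : ℝ) * b).toNNReal) ω)| ≤ b₀ :=
        (abs_sub _ _).trans (by rw [hb₀]; linarith [hu_b (U ((((j : ℝ) + 1) * b).toNNReal) ω), hu_b (U (((j : ℝ) * b).toNNReal) ω)])
      have h1 : -(l * (u (U ((((j : ℝ) + 1) * b).toNNReal) ω) - u (U (((j : ℝ) * b).toNNReal) ω))) ≤ b₀ * |l| := by
        calc -(l * (u (U ((((j : ℝ) + 1) * b).toNNReal) ω) - u (U (((j : ℝ) * b).toNNReal) ω)))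
            ≤ |l * (u (U ((((j : ℝ) + 1) * b).toNNReal) ω) - u (U (((j : ℝ) * b).toNNReal) ω))| := neg_le_abs _
          _ = |l| * |u (U ((((j : ℝ) + 1) * b).toNNReal) ω) - u (U (((j : ℝ) * b).toNNReal) ω)| := abs_mul _ _
          _ ≤ |l| * b₀ := mul_le_mul_of_nonneg_left hdu (abs_nonneg l)
          _ = b₀ * |l| := mul_comm _ _
      linarith
    have hNB : (n₀ : ℝ) * B ^ 2 ≤ 9 * b₀ * (b + b₀) := by
      have hnb : (n₀ : ℝ) * b₀ ≤ b + b₀ := by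
        have h1 := mul_lt_mul_of_pos_right hn₀lt hb₀0
        rw [add_mul, div_mul_cancel₀ _ hb₀0.ne', one_mul] at h1
        exact h1.le
      calc (n₀ : ℝ) * B ^ 2 ≤ n₀ * (3 * b₀) ^ 2 := by gcongr
        _ = 9 * b₀ * (n₀ * b₀) := by ring
        _ ≤ 9 * b₀ * (b + b₀) := by gcongr
    calc ∫ ω, Real.exp (l * Ij ω) ∂P ≤ ∫ ω, Real.exp (b₀ * |l|) * Real.exp (l * ∑ k ∈ Finset.Ico (j * n₀) ((j + 1) * n₀), D k ω) ∂P :=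
          integral_mono_of_nonneg (ae_of_all _ fun ω => (Real.exp_pos _).le) (hexpi.const_mul _) (ae_of_all _ hpt)
      _ = Real.exp (b₀ * |l|) * ∫ ω, Real.exp (l * ∑ k ∈ Finset.Ico (j * n₀) ((j + 1) * n₀), D k ω) ∂P := integral_const_mul _ _
      _ ≤ Real.exp (b₀ * |l|) * Real.exp (n₀ * (l ^ 2 * B ^ 2 / 2)) := mul_le_mul_of_nonneg_left hup (Real.exp_pos _).le
      _ ≤ Real.exp (b₀ * |l| + l ^ 2 * (9 * b₀ * (b + b₀)) / 2) := by
          rw [← Real.exp_add, Real.exp_le_exp]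
          have : (n₀ : ℝ) * (l ^ 2 * B ^ 2 / 2) = l ^ 2 / 2 * (n₀ * B ^ 2) := by ring
          rw [this]; nlinarith [sq_nonneg l]
  refine ⟨fun l => by simpa only [hb₀] using hmgf l, ?_⟩
  -- fourth moment: `λ = 1/√v`, `v = 9b₀(b+b₀) + b₀²`
  set v : ℝ := 9 * b₀ * (b + b₀) + b₀ ^ 2 with hv
  have hv0 : 0 < v := by positivity
  set l : ℝ := 1 / Real.sqrt v with hl
  have hsv : 0 < Real.sqrt v := Real.sqrt_pos.2 hv0
  have hl0 : 0 < l := by positivity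
  have hl2 : l ^ 2 = 1 / v := by rw [hl, one_div_pow, Real.sq_sqrt hv0.le]
  have hl4 : l ^ 4 = 1 / v ^ 2 := by rw [show l ^ 4 = (l ^ 2) ^ 2 by ring, hl2]; ring
  have hIm : Measurable Ij := by
    have h1 : Measurable (Function.uncurry fun (ω : Ω) (r : ℝ) => G (U r.toNNReal ω) - m) := hGhm.comp hJm
    exact (h1.stronglyMeasurable.integral_prod_right (ν := volume.restrict (Ioc ((j : ℝ) * b) (((j : ℝ) + 1) * b)))).measurable
  have hjj : (j : ℝ) * b ≤ ((j : ℝ) + 1) * b := by nlinarith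
  have hIb : ∀ ω, |Ij ω| ≤ 2 * b := fun ω => by
    have hh' := norm_setIntegral_le_of_norm_le_const (μ := volume) (s := Ioc ((j : ℝ) * b) (((j : ℝ) + 1) * b)) measure_Ioc_lt_top
      (fun r _ => show ‖G (U r.toNNReal ω) - m‖ ≤ 2 by rw [Real.norm_eq_abs]; exact hGhb _) (f := fun r => G (U r.toNNReal ω) - m)
    rw [Real.norm_eq_abs, Real.volume_real_Ioc_of_le hjj] at hh'
    calc |Ij ω| ≤ 2 * (((j : ℝ) + 1) * b - (j : ℝ) * b) := hh'
      _ = 2 * b := by ring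
  have hexpIi : ∀ l' : ℝ, Integrable (fun ω => Real.exp (l' * Ij ω)) P := fun l' =>
    (integrable_const (Real.exp (|l'| * (2 * b)))).mono' ((hIm.const_mul l').exp).aestronglyMeasurable (Eventually.of_forall fun ω => by
      rw [Real.norm_eq_abs, abs_of_pos (Real.exp_pos _), Real.exp_le_exp]
      calc l' * Ij ω ≤ |l' * Ij ω| := le_abs_self _
        _ = |l'| * |Ij ω| := abs_mul _ _
        _ ≤ |l'| * (2 * b) := mul_le_mul_of_nonneg_left (hIb ω) (abs_nonneg l'))
  have hI4i : Integrable (fun ω => Ij ω ^ 4) P := (integrable_const ((2 * b) ^ 4)).mono' (hIm.pow_const 4).aestronglyMeasurable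
    (Eventually.of_forall fun ω => by
      rw [Real.norm_eq_abs, abs_of_nonneg (by positivity), show Ij ω ^ 4 = |Ij ω| ^ 4 by
        rw [show (4 : ℕ) = 2 * 2 from rfl, pow_mul, pow_mul, sq_abs]]
      exact pow_le_pow_left₀ (abs_nonneg _) (hIb ω) 4)
  have hb₀l : b₀ * l ≤ 1 := by
    rw [hl, mul_one_div, div_le_one hsv, Real.le_sqrt hb₀0.le hv0.le, hv]
    have : 0 ≤ 9 * b₀ * (b + b₀) := by positivity
    linarith
  have hvl : l ^ 2 * (9 * b₀ * (b + b₀)) / 2 ≤ 1 / 2 := by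
    rw [hl2, div_le_div_iff_of_pos_right (by norm_num : (0:ℝ) < 2), one_div_mul_eq_div, div_le_one hv0, hv]
    have : 0 ≤ b₀ ^ 2 := sq_nonneg _
    linarith
  have hexp_bound : ∀ s : ℝ, |s| = l → ∫ ω, Real.exp (s * Ij ω) ∂P ≤ Real.exp (3 / 2) := by
    intro s hs
    have hs2 : s ^ 2 = l ^ 2 := by rw [← sq_abs, hs]
    refine (hmgf s).trans (Real.exp_le_exp.2 ?_)
    rw [hs, hs2]
    linarith
  have hpt : ∀ ω, Ij ω ^ 4 ≤ 24 / l ^ 4 * (Real.exp (l * Ij ω) + Real.exp (-(l * Ij ω))) := fun ω => pow_four_le_exp_add_exp hl0 _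
  calc ∫ ω, Ij ω ^ 4 ∂P ≤ ∫ ω, 24 / l ^ 4 * (Real.exp (l * Ij ω) + Real.exp (-(l * Ij ω))) ∂P :=
        integral_mono hI4i (((hexpIi l).add ((hexpIi (-l)).congr (ae_of_all _ fun ω => by simp [neg_mul]))).const_mul _) hpt
    _ = 24 / l ^ 4 * ((∫ ω, Real.exp (l * Ij ω) ∂P) + ∫ ω, Real.exp (-l * Ij ω) ∂P) := by
        rw [integral_const_mul, integral_add (hexpIi l) ((hexpIi (-l)).congr (ae_of_all _ fun ω => by simp [neg_mul]))]
        simp [neg_mul]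
    _ ≤ 24 / l ^ 4 * (Real.exp (3 / 2) + Real.exp (3 / 2)) := by
        gcongr
        · exact hexp_bound l (abs_of_pos hl0)
        · exact hexp_bound (-l) (by rw [abs_neg, abs_of_pos hl0])
    _ = 48 * Real.exp (3 / 2) * v ^ 2 := by rw [hl4]; field_simp; ring
    _ = 48 * Real.exp (3 / 2) * (9 * (2 * βu) * (b + 2 * βu) + (2 * βu) ^ 2) ^ 2 := by rw [hv, hb₀]

end Summit.QuantumFields.YangMills.Theorems.ColdStartUniversality

end
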